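import Summits.Ventures.HodgeRepro2.T6B1Incoherent

/-!
# T6B1Groups — (B1.c)/(B1.d): the unitary groups at the real places (Tier-6 sub-goal B1, proof lane)

TIER4 B1.3 / B1.4: «at every real place τ of F⁺, U(𝕍 ⊗_{A_F,τ} ℝ) ≅ U(3) is compact» and «G(τ)(ℝ) ≅ U(2,1) × U(3) × U(3)»
(the U(2,1) factor at τ). In kernel: the isometry group of a Gram matrix is transported by congruence
(`unitaryGroupOf_congr`: `Pᴴ H P = J` ⟹ `U(H) = P · U(J) · P⁻¹`), the isometry group of the identity matrix is
Mathlib's `Matrix.unitaryGroup` (`mem_unitaryGroupOf_one_iff`), and the Sylvester normal form `diag(1^p, (−1)^q)`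
is the standard `U(p, q)`; hence at every real place `w` the isometry group of `𝕍 ⊗ ℝ` (positive definite) is conjugate
to `U(3)`, and that of `W α ⊗ ℝ` is conjugate to `U(2, 1)` at `τ` and to `U(3)` at the other real places.
-/

namespace Summit.Ventures.HodgeRepro2.T6
namespace B1Groups

open NumberField Matrix B1Carriers B1Local B1Construct B1Incoherent
open scoped ComplexOrder

section general
variable {R : Type*} [CommRing R] [StarRing R] {n : ℕ}

/-- Membership in the isometry group of `H`. -/
theorem mem_unitaryGroupOf_iff (H : Matrix (Fin n) (Fin n) R) (g : GL (Fin n) R) :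
    g ∈ unitaryGroupOf H ↔ (g : Matrix (Fin n) (Fin n) R)ᴴ * H * g = H := Iff.rfl

/-- The isometry group of the identity matrix is Mathlib's unitary group. -/
theorem mem_unitaryGroupOf_one_iff (g : GL (Fin n) R) :
    g ∈ unitaryGroupOf (1 : Matrix (Fin n) (Fin n) R) ↔ (g : Matrix (Fin n) (Fin n) R) ∈ Matrix.unitaryGroup (Fin n) R := by
  rw [mem_unitaryGroupOf_iff, Matrix.mem_unitaryGroup_iff', Matrix.mul_one]
  rfl

/-- The standard group `U(p, q)`: the isometry group of `diag(1, …, 1, −1, …, −1)` with `p` ones. -/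
def standardUnitaryGroup (p : ℕ) : Subgroup (GL (Fin n) R) :=
  unitaryGroupOf (Matrix.diagonal (fun i : Fin n => if (i : ℕ) < p then (1 : R) else -1))

/-- Congruent Gram matrices have conjugate isometry groups: if `Pᴴ H P = J` then `U(H) = P · U(J) · P⁻¹`. -/
theorem unitaryGroupOf_congr (H J : Matrix (Fin n) (Fin n) R) (P : GL (Fin n) R)
    (hP : (P : Matrix (Fin n) (Fin n) R)ᴴ * H * P = J) :
    unitaryGroupOf H = (unitaryGroupOf J).map (MulAut.conj P).toMonoidHom := by
  have e1 : (P : Matrix (Fin n) (Fin n) R) * ((P⁻¹ : GL (Fin n) R) : Matrix (Fin n) (Fin n) R) = 1 := by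
    rw [← Units.val_mul, mul_inv_cancel, Units.val_one]
  have e2 : ((P⁻¹ : GL (Fin n) R) : Matrix (Fin n) (Fin n) R) * (P : Matrix (Fin n) (Fin n) R) = 1 := by
    rw [← Units.val_mul, inv_mul_cancel, Units.val_one]
  have e1' : ((P⁻¹ : GL (Fin n) R) : Matrix (Fin n) (Fin n) R)ᴴ * (P : Matrix (Fin n) (Fin n) R)ᴴ = 1 := by
    rw [← conjTranspose_mul, e1, conjTranspose_one]
  have hP' : (P : Matrix (Fin n) (Fin n) R)ᴴ * (H * P) = J := by rw [← Matrix.mul_assoc]; exact hP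
  ext g
  rw [Subgroup.mem_map]
  constructor
  · intro hg
    rw [mem_unitaryGroupOf_iff] at hg
    have hg' : (g : Matrix (Fin n) (Fin n) R)ᴴ * (H * g) = H := by rw [← Matrix.mul_assoc]; exact hg
    refine ⟨P⁻¹ * g * P, ?_, ?_⟩
    · rw [mem_unitaryGroupOf_iff, ← hP]
      simp only [Units.val_mul, conjTranspose_mul, Matrix.mul_assoc]
      rw [← Matrix.mul_assoc (P : Matrix (Fin n) (Fin n) R) ((P⁻¹ : GL (Fin n) R) : Matrix (Fin n) (Fin n) R),
        e1, Matrix.one_mul,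
        ← Matrix.mul_assoc ((P⁻¹ : GL (Fin n) R) : Matrix (Fin n) (Fin n) R)ᴴ (P : Matrix (Fin n) (Fin n) R)ᴴ,
        e1', Matrix.one_mul, ← Matrix.mul_assoc H (g : Matrix (Fin n) (Fin n) R),
        ← Matrix.mul_assoc (g : Matrix (Fin n) (Fin n) R)ᴴ, hg']
    · simp [MulAut.conj_apply, mul_assoc]
  · rintro ⟨h, hh, rfl⟩
    rw [mem_unitaryGroupOf_iff] at hh ⊢
    have hh' : (h : Matrix (Fin n) (Fin n) R)ᴴ * (J * h) = J := by rw [← Matrix.mul_assoc]; exact hh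
    simp only [MulEquiv.toMonoidHom_eq_coe, MonoidHom.coe_coe, MulAut.conj_apply, Units.val_mul, conjTranspose_mul,
      Matrix.mul_assoc]
    rw [← Matrix.mul_assoc H (P : Matrix (Fin n) (Fin n) R), ← Matrix.mul_assoc (P : Matrix (Fin n) (Fin n) R)ᴴ, hP',
      ← Matrix.mul_assoc J (h : Matrix (Fin n) (Fin n) R), ← Matrix.mul_assoc (h : Matrix (Fin n) (Fin n) R)ᴴ, hh',
      ← hP']
    simp only [Matrix.mul_assoc]
    rw [e1, Matrix.mul_one, ← Matrix.mul_assoc, e1', Matrix.one_mul]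

end general

/-- A Gram matrix of signature `(p, q)` over `ℂ` has isometry group conjugate to the standard `U(p, q)`. -/
theorem unitaryGroupOf_eq_of_hasSig {n : ℕ} {M : Matrix (Fin n) (Fin n) ℂ} {p q : ℕ} (h : HasSig M p q) :
    ∃ P : GL (Fin n) ℂ, unitaryGroupOf M = (standardUnitaryGroup p).map (MulAut.conj P).toMonoidHom := by
  obtain ⟨-, P, hP, hPM⟩ := h
  exact ⟨Matrix.GeneralLinearGroup.mkOfDetNeZero P (isUnit_iff_ne_zero.1 hP), unitaryGroupOf_congr M _ _ hPM⟩

/-- A positive definite Gram matrix `diag(1, 1, c)`, `c > 0`, has isometry group conjugate to `U(3)`. -/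
theorem unitaryGroupOf_diag_pos_eq {c : ℝ} (hc : 0 < c) :
    ∃ P : GL (Fin 3) ℂ, unitaryGroupOf (Matrix.diagonal ![1, 1, (c : ℂ)]) =
      (unitaryGroupOf (1 : Matrix (Fin 3) (Fin 3) ℂ)).map (MulAut.conj P).toMonoidHom := by
  have hs : Real.sqrt c * Real.sqrt c = c := Real.mul_self_sqrt hc.le
  have hs0 : Real.sqrt c ≠ 0 := (Real.sqrt_pos.2 hc).ne'
  set P : Matrix (Fin 3) (Fin 3) ℂ := Matrix.diagonal ![1, 1, ((1 / Real.sqrt c : ℝ) : ℂ)] with hPdef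
  have hPdet : IsUnit P.det := by
    rw [hPdef, Matrix.det_diagonal, Fin.prod_univ_three]
    simp only [Matrix.cons_val_zero, Matrix.cons_val_one, Matrix.cons_val_two, Matrix.head_cons,
      Matrix.tail_cons, one_mul]
    rw [isUnit_iff_ne_zero]
    exact_mod_cast one_div_ne_zero hs0
  refine ⟨Matrix.GeneralLinearGroup.mkOfDetNeZero P (isUnit_iff_ne_zero.1 hPdet), ?_⟩
  apply unitaryGroupOf_congr
  show Pᴴ * Matrix.diagonal ![1, 1, (c : ℂ)] * P = 1
  rw [hPdef, Matrix.diagonal_conjTranspose, Matrix.diagonal_mul_diagonal, Matrix.diagonal_mul_diagonal,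
    ← Matrix.diagonal_one]
  congr 1
  funext i
  fin_cases i
  · simp
  · simp
  · simp only [Fin.reduceFinMk, Matrix.cons_val_two, Matrix.tail_cons, Matrix.head_cons, Pi.star_apply,
      Complex.star_def, Complex.conj_ofReal, Fin.isValue]
    rw [← Complex.ofReal_mul, ← Complex.ofReal_mul]
    have : 1 / Real.sqrt c * c * (1 / Real.sqrt c) = c / (Real.sqrt c * Real.sqrt c) := by ring
    rw [this, hs, div_self hc.ne']; push_cast; rfl

variable (K : Type*) [Field K] [NumberField K]

/-- **(B1.c) at the real places.** For every real place `w` the isometry group of `𝕍 ⊗_{A_F,w} ℝ` is conjugate, inside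
`GL₃(ℂ)`, to the isometry group of the standard form — `U(3)`. -/
theorem unitaryGroupOf_V_real (θ : K) (τ : InfinitePlace K) {α : K} (hα : α ≠ 0) {w : InfinitePlace K}
    (hw : w.IsReal) (hpos : w ≠ τ → 0 < realOf K hw α) :
    ∃ P : GL (Fin 3) ℂ, unitaryGroupOf ((V K θ τ hα).gram.map (adelicToComplex K θ hw)) =
      (unitaryGroupOf (1 : Matrix (Fin 3) (Fin 3) ℂ)).map (MulAut.conj P).toMonoidHom := by
  classical
  rw [V_gramAt]
  by_cases hwτ : w = τ
  · simp only [hwτ, if_true]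
    exact unitaryGroupOf_diag_pos_eq zero_lt_one
  · simp only [hwτ, if_false]
    exact unitaryGroupOf_diag_pos_eq (hpos hwτ)

omit [NumberField K] in
/-- **(B1.d) at `τ`.** The isometry group of `W α ⊗_{F,τ} ℝ` is conjugate to the standard `U(2, 1)` when
`(α, θ)_τ = −1`. -/
theorem unitaryGroupOf_W_at_τ (θ : K) {α : K} (hα : α ≠ 0) {τ : InfinitePlace K} (hτ : τ.IsReal)
    (hθτ : realOf K hτ θ < 0) (hsym : hilbertInf K τ α θ = -1) :
    ∃ P : GL (Fin 3) ℂ, unitaryGroupOf (globalGramAt K (W K θ hα) hτ) =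
      (standardUnitaryGroup 2).map (MulAut.conj P).toMonoidHom :=
  unitaryGroupOf_eq_of_hasSig (hasSig_W_of_symbol_neg_one K θ hα hτ hθτ hsym)

omit [NumberField K] in
/-- **(B1.d) away from `τ`.** The isometry group of `W α ⊗_{F,w} ℝ` is conjugate to `U(3)` when `(α, θ)_w = 1`. -/
theorem unitaryGroupOf_W_away (θ : K) {α : K} (hα : α ≠ 0) {w : InfinitePlace K} (hw : w.IsReal)
    (hθw : realOf K hw θ < 0) (hsym : hilbertInf K w α θ = 1) :
    ∃ P : GL (Fin 3) ℂ, unitaryGroupOf (globalGramAt K (W K θ hα) hw) =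
      (unitaryGroupOf (1 : Matrix (Fin 3) (Fin 3) ℂ)).map (MulAut.conj P).toMonoidHom := by
  rw [globalGramAt_W]
  apply unitaryGroupOf_diag_pos_eq
  rw [hilbertInf_eq_real K hw, hilbertSymbol_real_eq_one_iff hθw] at hsym
  exact hsym

end B1Groups
end Summit.Ventures.HodgeRepro2.T6
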